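import Mathlib.AlgebraicGeometry.AffineTransitionLimit
import HarnessLib

/-!
# Limits of schemes: the images of a closed subset of the limit eventually lie in a given open

Topic: `Literature/AlgebraicGeometry/Limits` (EGA IV₃ §8; The Stacks Project, Limits of Schemes,
Tags 01Z2–01Z4). Setting (as in Mathlib's `Mathlib.AlgebraicGeometry.AffineTransitionLimit`): a cofiltered
diagram `D : I ⥤ Scheme` of quasi-compact schemes with affine transition maps and a limit cone `c`
(`X := c.pt = lim D i`, projections `πᵢ : X → D i`).

* `mem_of_forall_mem_closure_image` — **a closed subset `W ⊆ X` is the intersection of the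
  pull-backs of the closures of its images**: `W = ⋂ᵢ πᵢ⁻¹(cl πᵢ(W))` (the `πᵢ⁻¹(V)`, `V ⊆ D i` open,
  form a basis of `X`, Mathlib `isBasis_preimage_isAffineOpen`, Tag 01Z4);
* `exists_closure_image_subset_preimage` — **the images of a closed `W ⊆ X` eventually lie in a given
  open**: if `U ⊆ D i₀` is open with `W ⊆ π_{i₀}⁻¹(U)`, then `cl π_j(W) ⊆ (D j → D i₀)⁻¹(U)` for all
  `j` over some `i₁ → i₀`. Proof: otherwise the closed sets `cl π_j(W) ∖ (D j → D i₀)⁻¹(U)` are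
  non-empty, quasi-compact and compatible, so by Tag 01Z3 (Mathlib `exists_mem_of_isClosed_of_nonempty'`)
  there is `s ∈ X` with `π_j(s) ∈ cl π_j(W)` for all `j`, whence `s ∈ W` and `π_{i₀}(s) ∈ U`, a
  contradiction.

This is the topological input of the "eventual properness" step of the approximation of proper schemes
(The Stacks Project, Tags 081F, 09ZR) in the form used by
`Literature/AlgebraicGeometry/Morphisms/SteinFactorization*`: no finite presentation hypothesis and no
descent of morphisms is needed. Everything is proved; no named facts.

## References

* The Stacks Project, Tags 01Z2, 01Z3, 01Z4 (Limits of Schemes, Lemmas 32.4.x), 081F, 09ZR. [StacksProject]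
* A. Grothendieck, J. Dieudonné, EGA IV₃ (1966), §8.3, Thm. 8.10.5.
-/

noncomputable section

universe u

open CategoryTheory CategoryTheory.Limits AlgebraicGeometry TopologicalSpace

namespace Literature.AlgebraicGeometry.Limits

-- As in `Mathlib.AlgebraicGeometry.AffineTransitionLimit`: the cone legs `c.π.app i` have
-- source `((Functor.const I).obj c.pt).obj i`, definitionally `c.pt`.
set_option backward.isDefEq.respectTransparency false

variable {I : Type u} [Category.{u} I] (D : I ⥤ Scheme.{u}) (c : Cone D) (hc : IsLimit c)
  [IsCofiltered I] [∀ {i j : I} (f : i ⟶ j), IsAffineHom (D.map f)]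

omit [IsCofiltered I] [∀ {i j : I} (f : i ⟶ j), IsAffineHom (D.map f)] in
/-- The image of the closure of the image at a finer stage lies in the closure of the image. [folklore] -/
theorem image_closure_image_subset {i j : I} (f : j ⟶ i) (W : Set c.pt) :
    D.map f '' closure (c.π.app j '' W) ⊆ closure (c.π.app i '' W) := by
  refine (image_closure_subset_closure_image (D.map f).continuous).trans (closure_mono ?_)
  rw [← Set.image_comp]
  rintro _ ⟨x, hx, rfl⟩
  refine ⟨x, hx, ?_⟩
  change c.π.app i x = D.map f (c.π.app j x)
  rw [← Scheme.Hom.comp_apply, c.w f]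
  rfl

omit [IsCofiltered I] [∀ {i j : I} (f : i ⟶ j), IsAffineHom (D.map f)] in
/-- The closure of the image at a finer stage lies in the pull-back of the closure of the image.
[folklore] -/
theorem closure_image_subset_preimage {i j : I} (f : j ⟶ i) (W : Set c.pt) :
    closure (c.π.app j '' W) ⊆ D.map f ⁻¹' closure (c.π.app i '' W) :=
  Set.image_subset_iff.mp (image_closure_image_subset D c f W)

include hc in
/-- **A closed subset of the limit is the intersection of the pull-backs of the closures of its
images**: if `πᵢ(x)` lies in the closure of `πᵢ(W)` for every `i`, then `x ∈ W` (`W` closed). The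
`πᵢ⁻¹(V)`, `V ⊆ D i` affine open, form a basis of the limit (Tag 01Z4), and a basic open neighbourhood
of `x ∉ W` inside the complement of `W` gives an open `V ∋ πᵢ(x)` missing `πᵢ(W)`.
[cite: StacksProject, Tag 01Z4 (Limits of Schemes)] -/
theorem mem_of_forall_mem_closure_image {W : Set c.pt} (hW : IsClosed W) {x : c.pt}
    (hx : ∀ i, c.π.app i x ∈ closure (c.π.app i '' W)) : x ∈ W := by
  by_contra hxW
  have hxW' : x ∈ (⟨Wᶜ, hW.isOpen_compl⟩ : c.pt.Opens) := hxW
  obtain ⟨O, ⟨i, V, -, rfl⟩, hxO, hOW⟩ :=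
    (Opens.isBasis_iff_nbhd.mp (isBasis_preimage_isAffineOpen D c hc)) hxW'
  have hxV : c.π.app i x ∈ (V : Set (D.obj i)) := hxO
  obtain ⟨y, hyV, ⟨w, hw, rfl⟩⟩ := mem_closure_iff.mp (hx i) V V.isOpen hxV
  have hwO : w ∈ (c.π.app i ⁻¹ᵁ V : c.pt.Opens) := hyV
  exact hOW hwO hw

include hc in
/-- Variant: it suffices that `π_j(x)` lies in the closure of `π_j(W)` for all `j` over a fixed `i₀`.
[folklore] -/
theorem mem_of_forall_mem_closure_image' {W : Set c.pt} (hW : IsClosed W) {x : c.pt} (i₀ : I)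
    (hx : ∀ (j : I) (_ : j ⟶ i₀), c.π.app j x ∈ closure (c.π.app j '' W)) : x ∈ W := by
  refine mem_of_forall_mem_closure_image D c hc hW fun i => ?_
  let k := IsCofiltered.min i i₀
  have h := hx k (IsCofiltered.minToRight i i₀)
  have e : c.π.app i x = D.map (IsCofiltered.minToLeft i i₀) (c.π.app k x) := by
    rw [← Scheme.Hom.comp_apply, c.w]
    rfl
  rw [e]
  exact image_closure_image_subset D c (IsCofiltered.minToLeft i i₀) W ⟨_, h, rfl⟩

include hc in
/-- **The images of a closed subset of the limit eventually lie in a given open.** Let the `D i` be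
quasi-compact, `U ⊆ D i₀` open and `W ⊆ lim D i` closed with `W ⊆ π_{i₀}⁻¹(U)`. Then there is
`i₁ → i₀` such that `cl π_j(W) ⊆ (D j → D i₀)⁻¹(U)` for every `j → i₁`. (Otherwise the non-empty
quasi-compact closed sets `cl π_j(W) ∖ (D j → D i₀)⁻¹(U)` are compatible, and Tag 01Z3 produces a point
`s` of the limit with `π_j(s) ∈ cl π_j(W)` for all `j`, so `s ∈ W` by
`mem_of_forall_mem_closure_image`, yet `π_{i₀}(s) ∉ U`.)
[cite: StacksProject, Tag 01Z3 (Limits of Schemes)] -/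
theorem exists_closure_image_subset_preimage [∀ i, CompactSpace (D.obj i)] {i₀ : I}
    (U : (D.obj i₀).Opens) {W : Set c.pt} (hW : IsClosed W) (hWU : W ⊆ c.π.app i₀ ⁻¹' U) :
    ∃ (i₁ : I) (f₁ : i₁ ⟶ i₀), ∀ (j : I) (fj : j ⟶ i₁),
      closure (c.π.app j '' W) ⊆ D.map (fj ≫ f₁) ⁻¹' U := by
  -- the bad sets
  let Z : ∀ j : I, (j ⟶ i₀) → Set (D.obj j) := fun j h => closure (c.π.app j '' W) ∩ (D.map h ⁻¹' U)ᶜ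
  by_cases hZ : ∃ (j : I) (h : j ⟶ i₀), Z j h = ∅
  · obtain ⟨j, h, hjh⟩ := hZ
    refine ⟨j, h, fun j' fj => ?_⟩
    have hsub : closure (c.π.app j '' W) ⊆ D.map h ⁻¹' U := fun y hy => by
      by_contra hy'
      have : y ∈ Z j h := ⟨hy, hy'⟩
      rw [hjh] at this
      exact this
    refine (closure_image_subset_preimage D c fj W).trans ?_
    rw [Functor.map_comp, Scheme.Hom.comp_base, TopCat.coe_comp, Set.preimage_comp]
    exact Set.preimage_mono hsub
  · simp only [not_exists] at hZ
    obtain ⟨s, hs⟩ := exists_mem_of_isClosed_of_nonempty' D c hc Z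
      (fun j h => isClosed_closure.inter (U.isOpen.preimage (D.map h).continuous).isClosed_compl)
      (fun j h => Set.nonempty_iff_ne_empty.mpr (hZ j h))
      (fun j h => (isClosed_closure.inter (U.isOpen.preimage (D.map h).continuous).isClosed_compl).isCompact)
      (fun j j' hj'j hji₀ x hx => by
        refine ⟨image_closure_image_subset D c hj'j W ⟨x, hx.1, rfl⟩, fun hxU => hx.2 ?_⟩
        rw [Functor.map_comp, Scheme.Hom.comp_base, TopCat.coe_comp, Set.preimage_comp]
        exact hxU)
    have hsW : s ∈ W := mem_of_forall_mem_closure_image' D c hc hW i₀ fun j h => (hs j h).1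
    refine absurd ?_ (hs i₀ (𝟙 i₀)).2
    rw [Set.mem_preimage, ← Scheme.Hom.comp_apply, c.w]
    exact hWU hsW

end Literature.AlgebraicGeometry.Limits

end
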